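import Mathlib
import HarnessLib
import Summits.Ventures.LatticeQCDFlow.Exactness.NCMCGeneralSpaceBennettRootVariance

/-!
# Bennett's equation with unequal sample sizes `nf : nr = a : b`: root, sensitivity and noise at the root; the ratio is Bennett's bound `1/G_{a,b} − 1/a − 1/b`

HONEST FRAMING: exact (Metropolis-corrected) sampling algorithms for lattice gauge theory;
figures of merit are autocorrelation/cost numbers at stated couplings and volumes; no
continuum-physics claim.

Venture `LatticeQCDFlow` (cell pub-lqcd), topic `Exactness`; FANOUT row 13 (`eng-snf`, GEN-15).
NEW WORK of the cell (change-of-measure identities along a Crooks pair and bookkeeping), not a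
published result; nothing is cited as a fact (C. H. Bennett, J. Comput. Phys. 22 (1976) 245, eqs.
(8)–(12) named only).  The `a : b` generalisation of `NCMCGeneralSpaceBennettRootVariance.lean`
(`a = b = 1`): the engine runs `nf` forward and `nr` reverse evolutions, not always equally many, and
then solves Bennett's equation with the shift `M = log(nf/nr)` (`snf.estimators.bar`; the finite file's
`barFn M`).  With `nf = a·n`, `nr = b·n` one BLOCK of `a` forward and `b` reverse records contributes
`ψ_d = Σ_{l<a} σ(d − M − W_F,l) − Σ_{l<b} σ(W_R,l + M − d)`; writing `c = d − M`, everything is a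
statement about the single-record Fermi terms `σ(c − W)` (forward) and `σ(W − c)` (reverse) at the
SHIFTED ROOT `c⋆ = ΔF − M`, i.e. `e^{c⋆ − ΔF} = b/a`.

## Content (a Crooks pair with `e^{−ΔF} = Z₁/Z₀`; reals `a, b > 0`; `c⋆` with `a e^{c⋆−ΔF} = b`;
`u = σ(c⋆ − W)`, `g = E_{P_F} u`)

* **`CrooksPair.blocks_root`** — THE POPULATION EQUATION: `a E_F σ(c⋆ − W) = b E_R σ(W − c⋆)`
  (so with `M = log(a/b)` the population root of the block equation is `d = ΔF` exactly);
  `CrooksPair.blocks_root_iff` — `a E_F σ(c − W) = b E_R σ(W − c) ↔ a e^{c−ΔF} = b`.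
* `CrooksPair.integral_dsigmoid_rev_eq_blocks` — `b E_R[u(1 − u)] = a E_F[u²]`;
  `CrooksPair.integral_one_sub_sq_rev_eq_blocks` — `b E_R[(1 − u)²] = a E_F[u(1 − u)]`.
* **`CrooksPair.blocksSensitivity_eq`** — `κ_{a,b} := a E_F[u(1−u)] + b E_R[u(1−u)] = a g`;
  **`CrooksPair.blocksNoise_eq`** — `s²_{a,b} := a Var_F[u] + b Var_R[σ(W − c⋆)] = a g (1 − g (a + b)/b)`;
  **`CrooksPair.blocksNoise_div_sensitivity_sq_eq`** — `s²/κ² = 1/(a g) − 1/a − 1/b`.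
* **`CrooksPair.inv_mul_overlap_eq_bennett_bound`** — `a g = G_{a,b} := E_R[(e^{ΔF−W}/a + 1/b)⁻¹]`,
  hence `s²/κ² = 1/G_{a,b} − 1/a − 1/b`: LITERALLY the left side of GEN-11's `bennett_lower_bound` at
  `nf = a`, `nr = b` — the least asymptotic variance of any fixed-statistic two-sample estimator
  with those sample sizes, attained by the self-consistent root (companion CLT file).

Scope: population identities; the block root's consistency and CLT are the companion file
`NCMCGeneralSpaceBennettBlocksRoot.lean`.
-/

namespace Summit.Ventures.LatticeQCDFlow.Exactness.GeneralNCMC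

open MeasureTheory ProbabilityTheory Set Filter
open scoped ENNReal

variable {Ω E : Type*} [MeasurableSpace Ω] [MeasurableSpace E]

namespace CrooksPair

variable {ν₀ ν₁ : Measure Ω} {κF κR : Kernel Ω E} {s e : E → Ω} {W : E → ℝ}

/-! ## The population equation with a shift -/

/-- **`a E_F σ(c − W) = b E_R σ(W − c) ↔ a e^{c−ΔF} = b`** (`a, b > 0`): the shifted Bennett equation
holds exactly at `c = ΔF − log(a/b)`. -/
theorem blocks_root_iff [IsFiniteMeasure ν₀] [IsFiniteMeasure ν₁] [IsMarkovKernel κF]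
    [IsMarkovKernel κR] (h0 : ν₀ univ ≠ 0) (h1 : ν₁ univ ≠ 0) (h : CrooksPair ν₀ ν₁ κF κR s e W)
    {ΔF : ℝ} (hΔF : Real.exp (-ΔF) = ((ν₀ univ)⁻¹ * ν₁ univ).toReal) {a b : ℝ} (c : ℝ) :
    a * ∫ ε, Real.sigmoid (c - W ε) ∂(fwdPathLaw ν₀ κF) = b * ∫ ε, Real.sigmoid (W ε - c) ∂(fwdPathLaw ν₁ κR) ↔
      a * Real.exp (c - ΔF) = b := by
  have hR := h.integral_sigmoid_rev_pos h1 c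
  rw [h.integral_sigmoid_fwd_eq h0 h1 hΔF c, ← mul_assoc]
  exact mul_left_inj' hR.ne'

/-- **The population block equation holds at the shifted root**: if `a e^{c⋆−ΔF} = b` then
`a E_F σ(c⋆ − W) = b E_R σ(W − c⋆)`. -/
theorem blocks_root [IsFiniteMeasure ν₀] [IsFiniteMeasure ν₁] [IsMarkovKernel κF]
    [IsMarkovKernel κR] (h0 : ν₀ univ ≠ 0) (h1 : ν₁ univ ≠ 0) (h : CrooksPair ν₀ ν₁ κF κR s e W)
    {ΔF : ℝ} (hΔF : Real.exp (-ΔF) = ((ν₀ univ)⁻¹ * ν₁ univ).toReal) {a b c : ℝ}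
    (hc : a * Real.exp (c - ΔF) = b) :
    a * ∫ ε, Real.sigmoid (c - W ε) ∂(fwdPathLaw ν₀ κF) = b * ∫ ε, Real.sigmoid (W ε - c) ∂(fwdPathLaw ν₁ κR) :=
  (h.blocks_root_iff h0 h1 hΔF c).2 hc

omit [MeasurableSpace E] in
/-- Along the shifted root `e^{ΔF − W} = (a/b) e^{c⋆ − W}` (`a e^{c⋆−ΔF} = b`, `a ≠ 0`). -/
theorem exp_sub_eq_blocks {ΔF a b c : ℝ} (ha : a ≠ 0) (hc : a * Real.exp (c - ΔF) = b) (w : ℝ) :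
    Real.exp (ΔF - w) = a / b * Real.exp (c - w) := by
  have hb : b ≠ 0 := by rw [← hc]; exact mul_ne_zero ha (Real.exp_pos _).ne'
  have h1 : Real.exp (ΔF - c) = a / b := by
    rw [show ΔF - c = -(c - ΔF) by ring, Real.exp_neg, ← hc]
    field_simp
  rw [show ΔF - w = (ΔF - c) + (c - w) by ring, Real.exp_add, h1]

/-! ## Change of measure at the shifted root -/

/-- **`b E_R[u(1 − u)] = a E_F[u²]`**, `u = σ(c⋆ − W)`. -/
theorem integral_dsigmoid_rev_eq_blocks [IsFiniteMeasure ν₀] [IsFiniteMeasure ν₁] [IsMarkovKernel κF]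
    [IsMarkovKernel κR] (h0 : ν₀ univ ≠ 0) (h1 : ν₁ univ ≠ 0) (h : CrooksPair ν₀ ν₁ κF κR s e W)
    {ΔF : ℝ} (hΔF : Real.exp (-ΔF) = ((ν₀ univ)⁻¹ * ν₁ univ).toReal) {a b c : ℝ} (ha : 0 < a)
    (hc : a * Real.exp (c - ΔF) = b) :
    b * ∫ ε, Real.sigmoid (W ε - c) * (1 - Real.sigmoid (W ε - c)) ∂(fwdPathLaw ν₁ κR) =
      a * ∫ ε, Real.sigmoid (c - W ε) ^ 2 ∂(fwdPathLaw ν₀ κF) := by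
  have hb : 0 < b := by rw [← hc]; positivity
  rw [← h.integral_density_mul h0 h1 hΔF, ← integral_const_mul, ← integral_const_mul]
  refine integral_congr_ae (Eventually.of_forall fun ε => ?_)
  simp only
  rw [exp_sub_eq_blocks ha.ne' hc (W ε), one_sub_sigmoid_sub]
  have key := exp_sub_mul_sigmoid_sub c (W ε)
  calc b * (a / b * Real.exp (c - W ε) * (Real.sigmoid (W ε - c) * Real.sigmoid (c - W ε)))
      = a * (b / b) * ((Real.exp (c - W ε) * Real.sigmoid (W ε - c)) * Real.sigmoid (c - W ε)) := by
        ring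
    _ = a * Real.sigmoid (c - W ε) ^ 2 := by rw [div_self hb.ne', key, mul_one, sq]

/-- **`b E_R[(1 − u)²] = a E_F[u(1 − u)]`** (`1 − u = σ(W − c⋆)` on reverse records). -/
theorem integral_one_sub_sq_rev_eq_blocks [IsFiniteMeasure ν₀] [IsFiniteMeasure ν₁]
    [IsMarkovKernel κF] [IsMarkovKernel κR] (h0 : ν₀ univ ≠ 0) (h1 : ν₁ univ ≠ 0)
    (h : CrooksPair ν₀ ν₁ κF κR s e W) {ΔF : ℝ}
    (hΔF : Real.exp (-ΔF) = ((ν₀ univ)⁻¹ * ν₁ univ).toReal) {a b c : ℝ} (ha : 0 < a)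
    (hc : a * Real.exp (c - ΔF) = b) :
    b * ∫ ε, Real.sigmoid (W ε - c) ^ 2 ∂(fwdPathLaw ν₁ κR) =
      a * ∫ ε, Real.sigmoid (c - W ε) * (1 - Real.sigmoid (c - W ε)) ∂(fwdPathLaw ν₀ κF) := by
  have hb : 0 < b := by rw [← hc]; positivity
  rw [← h.integral_density_mul h0 h1 hΔF, ← integral_const_mul, ← integral_const_mul]
  refine integral_congr_ae (Eventually.of_forall fun ε => ?_)
  simp only
  rw [exp_sub_eq_blocks ha.ne' hc (W ε), one_sub_sigmoid_sub (W ε) c]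
  have key := exp_sub_mul_sigmoid_sub c (W ε)
  calc b * (a / b * Real.exp (c - W ε) * Real.sigmoid (W ε - c) ^ 2)
      = a * (b / b) * ((Real.exp (c - W ε) * Real.sigmoid (W ε - c)) * Real.sigmoid (W ε - c)) := by
        ring
    _ = a * (Real.sigmoid (c - W ε) * Real.sigmoid (W ε - c)) := by rw [div_self hb.ne', key, mul_one]

/-- `E_R[σ(W − c⋆)] = (a/b)·g`… in product form: `b E_R σ(W − c⋆) = a g`. -/
theorem integral_sigmoid_rev_eq_blocks [IsFiniteMeasure ν₀] [IsFiniteMeasure ν₁] [IsMarkovKernel κF]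
    [IsMarkovKernel κR] (h0 : ν₀ univ ≠ 0) (h1 : ν₁ univ ≠ 0) (h : CrooksPair ν₀ ν₁ κF κR s e W)
    {ΔF : ℝ} (hΔF : Real.exp (-ΔF) = ((ν₀ univ)⁻¹ * ν₁ univ).toReal) {a b c : ℝ}
    (hc : a * Real.exp (c - ΔF) = b) :
    b * ∫ ε, Real.sigmoid (W ε - c) ∂(fwdPathLaw ν₁ κR) = a * ∫ ε, Real.sigmoid (c - W ε) ∂(fwdPathLaw ν₀ κF) :=
  (h.blocks_root h0 h1 hΔF hc).symm

/-! ## Sensitivity, noise, their ratio -/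

/-- **The sensitivity of the block equation is `a g`**:
`a E_F[σ'(c⋆ − W)] + b E_R[σ'(W − c⋆)] = a E_F σ(c⋆ − W)` (`σ' = σ(1 − σ)`). -/
theorem blocksSensitivity_eq [IsFiniteMeasure ν₀] [IsFiniteMeasure ν₁] [IsMarkovKernel κF]
    [IsMarkovKernel κR] (h0 : ν₀ univ ≠ 0) (h1 : ν₁ univ ≠ 0) (h : CrooksPair ν₀ ν₁ κF κR s e W)
    {ΔF : ℝ} (hΔF : Real.exp (-ΔF) = ((ν₀ univ)⁻¹ * ν₁ univ).toReal) {a b c : ℝ} (ha : 0 < a)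
    (hc : a * Real.exp (c - ΔF) = b) :
    a * (∫ ε, Real.sigmoid (c - W ε) * (1 - Real.sigmoid (c - W ε)) ∂(fwdPathLaw ν₀ κF)) +
        b * ∫ ε, Real.sigmoid (W ε - c) * (1 - Real.sigmoid (W ε - c)) ∂(fwdPathLaw ν₁ κR) =
      a * ∫ ε, Real.sigmoid (c - W ε) ∂(fwdPathLaw ν₀ κF) := by
  haveI := isProbabilityMeasure_fwdPathLaw ν₀ h0 κF
  have hm : Measurable fun ε => c - W ε := measurable_const.sub h.measurable_W
  have hi1 : Integrable (fun ε => Real.sigmoid (c - W ε) * (1 - Real.sigmoid (c - W ε)))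
      (fwdPathLaw ν₀ κF) := by
    have := integrable_sigmoid_mul_sigmoid (μ := fwdPathLaw ν₀ κF) (f := fun ε => c - W ε)
      (g := fun ε => W ε - c) hm (h.measurable_W.sub measurable_const)
    refine this.congr (Eventually.of_forall fun ε => ?_)
    simp only
    rw [one_sub_sigmoid_sub (W ε) c]
  have hi2 : Integrable (fun ε => Real.sigmoid (c - W ε) ^ 2) (fwdPathLaw ν₀ κF) := by
    have := integrable_sigmoid_mul_sigmoid (μ := fwdPathLaw ν₀ κF) (f := fun ε => c - W ε)
      (g := fun ε => c - W ε) hm hm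
    refine this.congr (Eventually.of_forall fun ε => ?_)
    simp only
    rw [sq]
  rw [h.integral_dsigmoid_rev_eq_blocks h0 h1 hΔF ha hc, ← mul_add, ← integral_add hi1 hi2]
  congr 1
  refine integral_congr_ae (Eventually.of_forall fun ε => ?_)
  simp only
  ring

/-- `Var_F[σ(c − W)] = E_F[u²] − g²`. -/
theorem variance_sigmoid_fwd_eq' [IsFiniteMeasure ν₀] [IsMarkovKernel κF] (h0 : ν₀ univ ≠ 0)
    (h : CrooksPair ν₀ ν₁ κF κR s e W) (c : ℝ) :
    Var[fun ε => Real.sigmoid (c - W ε); fwdPathLaw ν₀ κF] =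
      (∫ ε, Real.sigmoid (c - W ε) ^ 2 ∂(fwdPathLaw ν₀ κF)) -
        (∫ ε, Real.sigmoid (c - W ε) ∂(fwdPathLaw ν₀ κF)) ^ 2 :=
  h.variance_sigmoid_fwd_eq h0 c

/-- `b² Var_R[σ(W − c⋆)] = a b E_F[u(1−u)] − a² g²` (both moments moved to the forward lane). -/
theorem variance_sigmoid_rev_eq_blocks [IsFiniteMeasure ν₀] [IsFiniteMeasure ν₁] [IsMarkovKernel κF]
    [IsMarkovKernel κR] (h0 : ν₀ univ ≠ 0) (h1 : ν₁ univ ≠ 0) (h : CrooksPair ν₀ ν₁ κF κR s e W)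
    {ΔF : ℝ} (hΔF : Real.exp (-ΔF) = ((ν₀ univ)⁻¹ * ν₁ univ).toReal) {a b c : ℝ} (ha : 0 < a)
    (hc : a * Real.exp (c - ΔF) = b) :
    b ^ 2 * Var[fun ε => Real.sigmoid (W ε - c); fwdPathLaw ν₁ κR] =
      a * b * (∫ ε, Real.sigmoid (c - W ε) * (1 - Real.sigmoid (c - W ε)) ∂(fwdPathLaw ν₀ κF)) -
        a ^ 2 * (∫ ε, Real.sigmoid (c - W ε) ∂(fwdPathLaw ν₀ κF)) ^ 2 := by
  haveI := isProbabilityMeasure_fwdPathLaw ν₁ h1 κR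
  rw [variance_eq_sub (memLp_two_sigmoid_comp (μ := fwdPathLaw ν₁ κR) (f := fun ε => W ε - c)
    (h.measurable_W.sub measurable_const))]
  have h2 := h.integral_one_sub_sq_rev_eq_blocks h0 h1 hΔF ha hc
  have h1' := h.integral_sigmoid_rev_eq_blocks h0 h1 hΔF hc
  simp only [Pi.pow_apply]
  rw [show b ^ 2 * ((∫ ε, Real.sigmoid (W ε - c) ^ 2 ∂(fwdPathLaw ν₁ κR)) -
      (∫ ε, Real.sigmoid (W ε - c) ∂(fwdPathLaw ν₁ κR)) ^ 2) =
      b * (b * ∫ ε, Real.sigmoid (W ε - c) ^ 2 ∂(fwdPathLaw ν₁ κR)) -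
        (b * ∫ ε, Real.sigmoid (W ε - c) ∂(fwdPathLaw ν₁ κR)) ^ 2 by ring, h2, h1']
  ring

/-- **The noise of the block equation**: `a Var_F[σ(c⋆ − W)] + b Var_R[σ(W − c⋆)] =
a g (1 − g (a + b)/b)` (the variance of one block's contribution, independent records). -/
theorem blocksNoise_eq [IsFiniteMeasure ν₀] [IsFiniteMeasure ν₁] [IsMarkovKernel κF]
    [IsMarkovKernel κR] (h0 : ν₀ univ ≠ 0) (h1 : ν₁ univ ≠ 0) (h : CrooksPair ν₀ ν₁ κF κR s e W)
    {ΔF : ℝ} (hΔF : Real.exp (-ΔF) = ((ν₀ univ)⁻¹ * ν₁ univ).toReal) {a b c : ℝ} (ha : 0 < a)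
    (hc : a * Real.exp (c - ΔF) = b) :
    a * Var[fun ε => Real.sigmoid (c - W ε); fwdPathLaw ν₀ κF] +
        b * Var[fun ε => Real.sigmoid (W ε - c); fwdPathLaw ν₁ κR] =
      a * (∫ ε, Real.sigmoid (c - W ε) ∂(fwdPathLaw ν₀ κF)) *
        (1 - (∫ ε, Real.sigmoid (c - W ε) ∂(fwdPathLaw ν₀ κF)) * (a + b) / b) := by
  have hb : 0 < b := by rw [← hc]; positivity
  have hBA : a * (∫ ε, Real.sigmoid (c - W ε) * (1 - Real.sigmoid (c - W ε)) ∂(fwdPathLaw ν₀ κF)) +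
      a * ∫ ε, Real.sigmoid (c - W ε) ^ 2 ∂(fwdPathLaw ν₀ κF) =
      a * ∫ ε, Real.sigmoid (c - W ε) ∂(fwdPathLaw ν₀ κF) := by
    rw [← h.integral_dsigmoid_rev_eq_blocks h0 h1 hΔF ha hc]
    exact h.blocksSensitivity_eq h0 h1 hΔF ha hc
  have hR := h.variance_sigmoid_rev_eq_blocks h0 h1 hΔF ha hc
  have hVF := h.variance_sigmoid_fwd_eq' h0 c
  set VF := Var[fun ε => Real.sigmoid (c - W ε); fwdPathLaw ν₀ κF] with hVFdef
  set VR := Var[fun ε => Real.sigmoid (W ε - c); fwdPathLaw ν₁ κR] with hVRdef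
  set g := ∫ ε, Real.sigmoid (c - W ε) ∂(fwdPathLaw ν₀ κF) with hgdef
  set A := ∫ ε, Real.sigmoid (c - W ε) ^ 2 ∂(fwdPathLaw ν₀ κF) with hAdef
  set B := ∫ ε, Real.sigmoid (c - W ε) * (1 - Real.sigmoid (c - W ε)) ∂(fwdPathLaw ν₀ κF) with hBdef
  have hdiv : g * (a + b) / b * b = g * (a + b) := div_mul_cancel₀ _ hb.ne'
  have key : b * (a * VF + b * VR) = b * (a * g * (1 - g * (a + b) / b)) := by
    rw [show b * (a * VF + b * VR) = a * b * VF + b ^ 2 * VR by ring, hR, hVF]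
    calc a * b * (A - g ^ 2) + (a * b * B - a ^ 2 * g ^ 2) = a * g * (b - g * (a + b)) := by
          linear_combination b * hBA
      _ = a * g * (b - g * (a + b) / b * b) := by rw [hdiv]
      _ = b * (a * g * (1 - g * (a + b) / b)) := by ring
  exact mul_left_cancel₀ hb.ne' key

/-- **The block overlap `a g` is positive.** -/
theorem mul_overlap_pos [IsFiniteMeasure ν₀] [IsMarkovKernel κF] (h0 : ν₀ univ ≠ 0)
    (h : CrooksPair ν₀ ν₁ κF κR s e W) {a : ℝ} (ha : 0 < a) (c : ℝ) :
    0 < a * ∫ ε, Real.sigmoid (c - W ε) ∂(fwdPathLaw ν₀ κF) :=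
  mul_pos ha (h.overlap_pos h0 c)

/-- **Noise over squared sensitivity**: `s²/κ² = 1/(a g) − 1/a − 1/b`. -/
theorem blocksNoise_div_sensitivity_sq_eq [IsFiniteMeasure ν₀] [IsFiniteMeasure ν₁]
    [IsMarkovKernel κF] [IsMarkovKernel κR] (h0 : ν₀ univ ≠ 0) (h1 : ν₁ univ ≠ 0)
    (h : CrooksPair ν₀ ν₁ κF κR s e W) {ΔF : ℝ}
    (hΔF : Real.exp (-ΔF) = ((ν₀ univ)⁻¹ * ν₁ univ).toReal) {a b c : ℝ} (ha : 0 < a)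
    (hc : a * Real.exp (c - ΔF) = b) :
    (a * Var[fun ε => Real.sigmoid (c - W ε); fwdPathLaw ν₀ κF] +
        b * Var[fun ε => Real.sigmoid (W ε - c); fwdPathLaw ν₁ κR]) /
      (a * (∫ ε, Real.sigmoid (c - W ε) * (1 - Real.sigmoid (c - W ε)) ∂(fwdPathLaw ν₀ κF)) +
        b * ∫ ε, Real.sigmoid (W ε - c) * (1 - Real.sigmoid (W ε - c)) ∂(fwdPathLaw ν₁ κR)) ^ 2 =
      1 / (a * ∫ ε, Real.sigmoid (c - W ε) ∂(fwdPathLaw ν₀ κF)) - 1 / a - 1 / b := by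
  have hb : 0 < b := by rw [← hc]; positivity
  have hG := h.overlap_pos h0 c
  rw [h.blocksNoise_eq h0 h1 hΔF ha hc, h.blocksSensitivity_eq h0 h1 hΔF ha hc]
  have hG' := (h.mul_overlap_pos h0 ha c).ne'
  rw [div_eq_iff (pow_ne_zero 2 hG')]
  field_simp
  ring

/-- **`a g` is Bennett's `G` at `nf = a`, `nr = b`**: `E_R[(e^{ΔF−W}/a + 1/b)⁻¹] = a E_F σ(c⋆ − W)`
(pointwise `(e^{ΔF−W}/a + 1/b)⁻¹ = b σ(W − c⋆)` along `a e^{c⋆−ΔF} = b`). -/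
theorem inv_mul_overlap_eq_bennett_bound [IsFiniteMeasure ν₀] [IsFiniteMeasure ν₁]
    [IsMarkovKernel κF] [IsMarkovKernel κR] (h0 : ν₀ univ ≠ 0) (h1 : ν₁ univ ≠ 0)
    (h : CrooksPair ν₀ ν₁ κF κR s e W) {ΔF : ℝ}
    (hΔF : Real.exp (-ΔF) = ((ν₀ univ)⁻¹ * ν₁ univ).toReal) {a b c : ℝ} (ha : 0 < a)
    (hc : a * Real.exp (c - ΔF) = b) :
    ∫ ε, (Real.exp (ΔF - W ε) / a + 1 / b)⁻¹ ∂(fwdPathLaw ν₁ κR) =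
      a * ∫ ε, Real.sigmoid (c - W ε) ∂(fwdPathLaw ν₀ κF) := by
  have hb : 0 < b := by rw [← hc]; positivity
  rw [← h.integral_sigmoid_rev_eq_blocks h0 h1 hΔF hc, ← integral_const_mul]
  refine integral_congr_ae (Eventually.of_forall fun ε => ?_)
  simp only
  rw [exp_sub_eq_blocks ha.ne' hc (W ε), Real.sigmoid_def, show -(W ε - c) = c - W ε by ring]
  field_simp
  ring

/-- **The ratio is Bennett's bound at `(a, b)`**: `s²/κ² = 1/E_R[(e^{ΔF−W}/a + 1/b)⁻¹] − 1/a − 1/b`,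
the left side of `NCMCGeneralSpaceBennettOptimal.bennett_lower_bound` with `nf = a`, `nr = b`. -/
theorem blocksNoise_div_sensitivity_sq_eq_bennett_bound [IsFiniteMeasure ν₀] [IsFiniteMeasure ν₁]
    [IsMarkovKernel κF] [IsMarkovKernel κR] (h0 : ν₀ univ ≠ 0) (h1 : ν₁ univ ≠ 0)
    (h : CrooksPair ν₀ ν₁ κF κR s e W) {ΔF : ℝ}
    (hΔF : Real.exp (-ΔF) = ((ν₀ univ)⁻¹ * ν₁ univ).toReal) {a b c : ℝ} (ha : 0 < a)
    (hc : a * Real.exp (c - ΔF) = b) :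
    (a * Var[fun ε => Real.sigmoid (c - W ε); fwdPathLaw ν₀ κF] +
        b * Var[fun ε => Real.sigmoid (W ε - c); fwdPathLaw ν₁ κR]) /
      (a * (∫ ε, Real.sigmoid (c - W ε) * (1 - Real.sigmoid (c - W ε)) ∂(fwdPathLaw ν₀ κF)) +
        b * ∫ ε, Real.sigmoid (W ε - c) * (1 - Real.sigmoid (W ε - c)) ∂(fwdPathLaw ν₁ κR)) ^ 2 =
      1 / (∫ ε, (Real.exp (ΔF - W ε) / a + 1 / b)⁻¹ ∂(fwdPathLaw ν₁ κR)) - 1 / a - 1 / b := by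
  rw [h.inv_mul_overlap_eq_bennett_bound h0 h1 hΔF ha hc]
  exact h.blocksNoise_div_sensitivity_sq_eq h0 h1 hΔF ha hc

end CrooksPair

end Summit.Ventures.LatticeQCDFlow.Exactness.GeneralNCMC
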